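import Literature.AlgebraicGeometry.Resolution.SigmaMaxEliminationInDim
import Literature.AlgebraicGeometry.Resolution.BlowupsProperProofs
import Mathlib.AlgebraicGeometry.Morphisms.Proper
import Mathlib.AlgebraicGeometry.Noetherian
import HarnessLib

/-!
# Blowing ups (and opens) of excellent locally Noetherian schemes are excellent

Topic: `Literature/AlgebraicGeometry/Resolution`. Sibling of `QuasiExcellentBlowup.lean` (the quasi-excellent half,
`IsBlowup.isQuasiExcellent`) and of `SigmaMaxEliminationInDim.lean` (`Scheme.IsExcellent.of_locallyOfFiniteType`:
a locally Noetherian scheme locally of finite type over an excellent scheme is excellent, Matsumura §32 p. 260 /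
Stacks 07QU, PROVED there). This file only composes:

* `IsBlowup.isLocallyNoetherian'` — the source of a blowing up of a locally Noetherian scheme is locally Noetherian
  (the blowing up is proper, `IsBlowup.isProper`, hence locally of finite type);
* `IsBlowup.isExcellent` — **the blowing up `X' → X` of an excellent locally Noetherian scheme `X` in any ideal sheaf
  is excellent**;
* `isExcellent_of_isBlowup` — the same, stated with the binder order
  `∀ {Y Y'} [IsLocallyNoetherian Y] {π : Y' ⟶ Y} {I}, IsBlowup π I → Y excellent → Y' excellent` used as an explicit
  hypothesis by tower arguments (e.g. the `hEXC` binder of the W4.2 crux chain's grade-one files), so that such a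
  hypothesis is discharged BY NAME;
* `Scheme.IsExcellent.of_isOpenImmersion` — an open subscheme of an excellent locally Noetherian scheme is excellent.

PROOF file (no definition, no named fact). AI-written plumbing; weaker than expert review.

## Sources

* H. Matsumura, *Commutative Ring Theory* (1986), §32, p. 260 (excellence is preserved under finite type and
  localization). [Matsumura1987]
* The Stacks Project, Tag 07QU (finite type over (quasi-)excellent), Tag 02NS (blowing ups in finite type ideal
  sheaves are proper). [StacksProject]
-/

noncomputable section

open CategoryTheory AlgebraicGeometry TopologicalSpace

namespace Literature.AlgebraicGeometry.Resolution

universe u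

/-- **The source of a blowing up of a locally Noetherian scheme is locally Noetherian**: the blowing up is proper
(`IsBlowup.isProper`, Görtz–Wedhorn I Prop. 13.96 (1)), in particular locally of finite type over a locally Noetherian
scheme. (Primed name: the unprimed statement lives in `NormalCrossingsBlowupStepReduction.lean` as
`isLocallyNoetherian_of_isBlowup`, behind heavier imports.) [cite: GortzWedhorn2020, Prop. 13.96 (1)] -/
theorem IsBlowup.isLocallyNoetherian' {X' X : Scheme.{u}} [IsLocallyNoetherian X] {π : X' ⟶ X}
    {I : X.IdealSheafData} (hπ : IsBlowup π I) : IsLocallyNoetherian X' := by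
  haveI : IsProper π := hπ.isProper
  exact LocallyOfFiniteType.isLocallyNoetherian π

/-- **A blowing up of an excellent locally Noetherian scheme is excellent**: `π : X' → X` a blowing up of `X` in an
ideal sheaf `I`, `X` locally Noetherian and excellent ⟹ `X'` excellent — `π` is proper, hence locally of finite type,
`X'` is locally Noetherian, and a locally Noetherian scheme locally of finite type over an excellent scheme is
excellent (`Scheme.IsExcellent.of_locallyOfFiniteType`, Matsumura §32 p. 260 / Stacks 07QU).
[cite: Matsumura1987, §32 p. 260] -/
theorem IsBlowup.isExcellent {X' X : Scheme.{u}} [IsLocallyNoetherian X] {π : X' ⟶ X} {I : X.IdealSheafData}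
    (hπ : IsBlowup π I) (hX : Scheme.IsExcellent X) : Scheme.IsExcellent X' := by
  haveI : IsProper π := hπ.isProper
  haveI : IsLocallyNoetherian X' := hπ.isLocallyNoetherian'
  exact Scheme.IsExcellent.of_locallyOfFiniteType π hX

/-- **Excellence passes to blowing ups**, in the binder order `∀ {Y Y'} [IsLocallyNoetherian Y] {π : Y' ⟶ Y} {I},
IsBlowup π I → Y excellent → Y' excellent` (the shape in which tower arguments carry it as an explicit hypothesis;
this closed term discharges such a hypothesis by name). [cite: Matsumura1987, §32 p. 260] -/
theorem isExcellent_of_isBlowup :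
    ∀ {Y Y' : Scheme.{u}} [IsLocallyNoetherian Y] {π : Y' ⟶ Y} {I : Y.IdealSheafData},
      IsBlowup π I → Scheme.IsExcellent Y → Scheme.IsExcellent Y' :=
  fun hπ hY => hπ.isExcellent hY

/-- **An open subscheme of an excellent locally Noetherian scheme is excellent**: an open immersion is locally of
finite type and its source is locally Noetherian. [cite: Matsumura1987, §32 p. 260] -/
theorem Scheme.IsExcellent.of_isOpenImmersion {U X : Scheme.{u}} (j : U ⟶ X) [IsOpenImmersion j]
    [IsLocallyNoetherian X] (hX : Scheme.IsExcellent X) : Scheme.IsExcellent U := by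
  haveI : IsLocallyNoetherian U := isLocallyNoetherian_of_isOpenImmersion j
  exact Scheme.IsExcellent.of_locallyOfFiniteType j hX

/-- **Every member of a sequence of blowing ups over an excellent locally Noetherian scheme is excellent** (and
locally Noetherian): for schemes `W j` with `W 0` locally Noetherian and excellent and blowing ups
`π j : W (j+1) → W j` in ideal sheaves `I j`, every `W j` is locally Noetherian and excellent (CJS p. 85: the class of
excellent schemes is stable under the blow-ups considered). [cite: Matsumura1987, §32 p. 260] -/
theorem isLocallyNoetherian_and_isExcellent_of_isBlowup_nat {W : ℕ → Scheme.{u}} [IsLocallyNoetherian (W 0)]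
    (h0 : Scheme.IsExcellent (W 0)) (I : ∀ j, (W j).IdealSheafData) (π : ∀ j, W (j + 1) ⟶ W j)
    (hπ : ∀ j, IsBlowup (π j) (I j)) :
    ∀ j, ∃ _ : IsLocallyNoetherian (W j), Scheme.IsExcellent (W j) := by
  intro j
  induction j with
  | zero => exact ⟨inferInstance, h0⟩
  | succ j ih =>
    obtain ⟨hN, hE⟩ := ih
    exact ⟨(hπ j).isLocallyNoetherian', (hπ j).isExcellent hE⟩

end Literature.AlgebraicGeometry.Resolution

end
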